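import Summits.QuantumFields.YangMills.Theorems.BalabanUVNodesN17AtBetaOfRecord
import Literature.MathematicalPhysics.QuantumFieldTheory.Balaban1983to89.T4RateAlgebra

/-!
# BalabanUVNodes ∕ N17 AT THE STAGE-8 β OF RECORD, part 2 (§17–§19): the in-edges of N17 in KERNEL CURRENCY on the record's own polarisation
# kernels `Node00.polLimit`, the box CAP (kernel negative) and its guard, non-vacuity of the split road at the record

TRACK A (YM-PLAN v0.12.16 §2c row NE4, node N17 of 28; HUMAN RULING D-0062), seat `pub-ymgap-dag-n17-a` gen 3 (-a = KNIT-BY-NAME).  Continues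
`BalabanUVNodesN17AtBetaOfRecord.lean` (§13–§16: box reading, split road under one-loop rigidity, (AF-0r) delivered by the node at the record, the node
on a datum carrying `Node00.betaOfMerged`).  THEOREMS ONLY: def-free, sorry-free, standard axioms.  HONEST FRAMING: count-neutral kernel
bookkeeping; NE4 NOT IN PRINT ([Balaban1987RG1] p. 264), NOT PROVED, DEPENDENT (rows NE2∕NE3 = N15∕N16, (AF-0r)); every kernel rate below is a
BINDER — (UD) = (5.10) p. 293 at the record's kernels (asserted in print for Bałaban's kernels, a hypothesis here), the step rates NOT PRINTED (King's
(4.38) is the A = 0 template); the term families are PARAMETERS; nothing of Bałaban's asserted; one finite T⁴ at fixed ε — nothing continuum ∕ ℝ⁴ ∕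
OS ∕ mass-gap ∕ Clay.

WHAT IS PROVED.
* §17 THE IN-EDGES IN KERNEL CURRENCY ON THE RECORD'S OWN OBJECTS.  The merged β of record is `β_merged,k+1(v) = Σ_x Π_{k+1,01}(v; x) x₀x₁` with
  `Π_{k+1}(v; ·) := Node00.polLimit F (k+1) (ℰ k v ·) ρ bV` the limiting polarisation kernel (1.21) of the record's term family — BY `rfl`, no
  `Beta.OneLoopDictionary` posited.  Dominated summation of (1.22) (`Beta.LimitRate.secondMoment_subKernel` + `B12Sec2to5.secondMoment_abs_le_of_decay510`
  on the difference kernel) gives: (UD) k-uniform (5.10)-decay of `Π_{k+1,01}(v; ·)` on the boxes ∧ the HISTORY-MATCHED KERNEL STEP RATE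
  `|Π_{k+2,01}(w; x) − Π_{k+1,01}(tail w; x)| ≤ C′θ^k e^{−δ′|x|₁}` on the boxes ⟹ `ScaleShiftRate (β′(C′,δ′)) θ γ' β_merged`
  (`scaleShiftRate_secondMoment_of_kernelStepRate`, `scaleShiftRate_betaMerged_of_kernelStepRate`) — NE4 at the record REDUCED to an η-rate of the
  record's kernels, the currency in which rows NE2 (N15: `T4RateAlgebra.RatePair` ∕ `UnitStepIneq` = `T4EtaRate.EtaRateIneqUnit` at `U ≡ 1`, the
  linear layer) and NE3∕NE5 (N16∕N18: the background ∕ minimiser layers carrying the history dependence) deliver, closed under the kernel algebra of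
  `T4RateAlgebra` §2.  Design (α): (AF-0r) for the record's `beta0OfTerms` ⇐ a `RatePair` of the `(0,1)` component of the coupling-free family's
  limiting kernels, `β⁰_∞ = Σ_x Π⁰_∞ x₀x₁` of the TELESCOPED limit kernel `Beta.LimitRate.limKernelOf`, `c₀ = β′(C′∕(1−θ), δ)`
  (`af0r_beta0OfTerms_of_ratePair` = `StepRate.geometricRate` + `abs_secondMoment_sub_limit_le` BY NAME); the (α) headline
  `scaleShiftRate_betaOfTerms_of_kernelRates` and its datum form `N17_atRecordTerms_of_kernelRates`; and, END TO END at the definer's (β) assembly line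
  `betaOfMerged (betaMerged F ℰ ρ bV) (beta0OfMerged … v₀) γ`: kernel rates ∧ `Beta0LimitExists` ⟹ N17 on the datum ∧ (AF-0r) of the record's one-loop
  number (`N17_atAssemblyLine_of_kernelStepRate`, part 1 §15 composed with §17).
* §18 THE CAP AND THE GUARD (kernel negative; A6-species pin for the crux text, same species as N28's `exists_printedShape_gammaCap`).  For the printed
  shape `β_merged,k+1(v) = 1 + g_k` (N17 holds for it with constant `0` on EVERY box: `scaleShiftRate_lastCoupling`) and record box side `γ > 0`, the
  β of record VIOLATES `ScaleShiftRate c θ γ'` for EVERY `c`, EVERY `γ' > γ` and every `θ < 1` (`not_scaleShiftRate_betaOfMerged_faceJump`: the history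
  `(γ', γ, …, γ)` is off the record box at scale `k+1` — value `β⁰ = 1` — while its tail is on it at scale `k` — value `1 + γ` —, a shift `γ` at every
  scale); packaged with the honest `limUnder` one-loop number (`exists_printedShape_scaleShiftCap`).  So the crux text «`NE4OnData D₀ c θ γ'`» must take
  `γ' ≤ θ.γ`.  Guard: for `γ ≤ 0` the β of record is the constant family `β⁰` and N17 at the record (`γ' > 0`) IS the Cauchy form of (AF-0r)
  (`scaleShiftRate_betaOfMerged_of_nonpos_iff`).
* §19 NON-VACUITY of §14–§15 at the record: the toy `β_merged,k+1(v) = 1 + 2^{−k} + g_k 2^{−k}`, `β⁰_k = 1 + 2^{−k}` (= the honest `g_k → 0⁺` limit,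
  `toy_beta0`): (AF-0r) with `β⁰_∞ = 1`, `c₀ = 1` (`toy_conv`); remainder rate `1` (`toy_remainderRate`); N17 of the merged β and AT THE RECORD with
  constant `3`, rate `½`, box `1` (`N17_atRecord_toy`); and of §17's kernel road on `T4RateAlgebra.Witness.X` (`kernelRoad_toy`).
Sources (locators only): T. Bałaban, CMP **109** (1987) 249–301 [Balaban1987RG1]: (1.20)–(1.22) p. 264, (2.12)–(2.14) p. 268, (5.10) p. 293;
C. King, CMP **102** (1986) 649–677 [King1986] Lemma 4.5 (4.38) p. 674 (the printed A = 0 step-rate template).  Nothing here is a claim about the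
Yang–Mills mass gap.
-/

namespace Summit.QuantumFields.YangMills.Theorems.BalabanUVNodesN17

open Filter Topology
open Literature.MathematicalPhysics.QuantumFieldTheory.Balaban1983to89
open Literature.MathematicalPhysics.QuantumFieldTheory.Balaban1983to89.FlowStep
open Literature.MathematicalPhysics.QuantumFieldTheory.Balaban1983to89.T4CouplingMatching
open Literature.MathematicalPhysics.QuantumFieldTheory.Balaban1983to89.T4Continuum
open Literature.MathematicalPhysics.QuantumFieldTheory.Balaban1983to89.T4FlagMemory (tail_mem_box)
open Literature.MathematicalPhysics.QuantumFieldTheory.Balaban1983to89.B12Sec2to5 (l1 Decay510 betaPrime510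
  secondMoment_abs_le_of_decay510)
open Literature.MathematicalPhysics.QuantumFieldTheory.Balaban1983to89.Beta.LimitRate (subKernel subKernel_apply
  secondMoment_subKernel limKernelOf)
open Literature.MathematicalPhysics.QuantumFieldTheory.Balaban1983to89.Node00 (betaOfMerged beta0OfMerged betaMerged
  betaOfTerms beta0OfTerms beta1OfTerms TermFamily0 TermFamily1 polLimit Beta0LimitExists betaOfMerged_of_mem betaOfMerged_of_notMem)
open Summit.QuantumFields.YangMills.BalabanUVNodes.N28AtBetaOfRecord (betaOfMerged_of_nonpos faceJump_beta0)
open Summit.QuantumFields.BalabanUV.T4Continuum.Spine.NE4 (NE4OnData ne4OnData_iff)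

universe u

/-! ## §17 THE IN-EDGES IN KERNEL CURRENCY on the record's own objects: η-rates of the limiting polarisation kernels ⟹ N17 of the merged β;
design (α): a rate pair of the coupling-free kernels ⟹ (AF-0r) for `beta0OfTerms` -/

section KernelCurrency

/-- **DOMINATED SUMMATION OF (1.22), HISTORY-INDEXED.**  For a history-indexed family of `ℤ^d`-kernels `Π_{k+1}(v; ·)` read in the `(μ,ν)` component:
(UD) `|Π_{k+1,μν}(v; x)| ≤ C e^{−δ|x|₁}` on the boxes ((5.10) p. 293, k- and history-uniform) and the HISTORY-MATCHED STEP RATE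
`|Π_{k+2,μν}(w; x) − Π_{k+1,μν}(tail w; x)| ≤ C′θ^k e^{−δ′|x|₁}` on the boxes ⟹ the second moments `β(v) := Σ_x Π(v; x) x_μ x_ν` satisfy
`ScaleShiftRate (β′(C′,δ′)) θ γ'` (`Beta.LimitRate.secondMoment_subKernel` + `B12Sec2to5.secondMoment_abs_le_of_decay510` on the difference kernel;
`β′(C′,δ′) = C′Σ_x|x|₁²e^{−δ′|x|₁}`).  The step rate is NOT PRINTED (King's (4.38) is the A = 0 template). [cite: King1986, Lemma 4.5 (4.38) p.674] -/
theorem scaleShiftRate_secondMoment_of_kernelStepRate {d : ℕ} {Pk : (k : ℕ) → (Fin (k + 1) → ℝ) → B12Beta.Kernel d}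
    {μ ν : Fin d} {C δ C' δ' θ γ' : ℝ} (hδ : 0 < δ) (hδ' : 0 < δ')
    (hU : ∀ k (v : Fin (k + 1) → ℝ), v ∈ Box γ' k → Decay510 (Pk k v μ ν) C δ)
    (hS : ∀ k (w : Fin (k + 2) → ℝ), w ∈ Box γ' (k + 1) →
      Decay510 (subKernel (Pk (k + 1) w) (Pk k (Fin.tail w)) μ ν) (C' * θ ^ k) δ') :
    ScaleShiftRate (betaPrime510 d C' δ') θ γ' fun k v => B12Beta.secondMoment (Pk k v) μ ν := by
  intro k w hw
  have hsum1 := (secondMoment_abs_le_of_decay510 (P := Pk (k + 1) w) hδ (hU (k + 1) w hw)).1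
  have hsum0 := (secondMoment_abs_le_of_decay510 (P := Pk k (Fin.tail w)) hδ (hU k _ (tail_mem_box hw))).1
  have hD := (secondMoment_abs_le_of_decay510 (P := subKernel (Pk (k + 1) w) (Pk k (Fin.tail w))) hδ' (hS k w hw)).2
  show |B12Beta.secondMoment (Pk (k + 1) w) μ ν - B12Beta.secondMoment (Pk k (Fin.tail w)) μ ν| ≤ betaPrime510 d C' δ' * θ ^ k
  rw [← secondMoment_subKernel _ _ μ ν hsum1 hsum0]
  calc |B12Beta.secondMoment (subKernel (Pk (k + 1) w) (Pk k (Fin.tail w))) μ ν|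
      ≤ C' * θ ^ k * ∑' x : Fin d → ℤ, l1 x ^ 2 * Real.exp (-δ' * l1 x) := hD
    _ = betaPrime510 d C' δ' * θ ^ k := by unfold betaPrime510; ring

variable {𝔄 : Type*} [NormedRing 𝔄] [NormedAlgebra ℝ 𝔄]
variable {V : Type*} [NormedAddCommGroup V] [NormedSpace ℝ V] {ι : Type*} [Fintype ι]

/-- **N17 OF THE MERGED β OF RECORD ⇐ η-RATES OF THE RECORD'S OWN KERNELS.**  The merged β of `Node00.BetaOfRecord` is, by `rfl`,
`β_merged,k+1(v) = Σ_x Π_{k+1,01}(v; x) x₀x₁` with `Π_{k+1}(v; ·) := Node00.polLimit F (k+1) (ℰ k v ·) ρ bV` the limit (1.21) of the record's term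
family — no one-loop dictionary posited.  Hence (UD) on the boxes ∧ the history-matched kernel step rate of THOSE kernels ⟹
`ScaleShiftRate (β′(C′,δ′)) θ γ' (betaMerged F ℰ ρ bV)`: NE4 at the record in the kernel currency in which rows NE2 (N15; `T4RateAlgebra.RatePair`, the
linear layer) and NE3∕NE5 (N16∕N18; the history-carrying layers) deliver.  Both kernel inputs are BINDERS, not in print.
[cite: Balaban1987RG1, (1.21)-(1.22) p.264 and (5.10) p.293] -/
theorem scaleShiftRate_betaMerged_of_kernelStepRate (F : T4Family) (ℰ : TermFamily1 F 𝔄) (ρ : V →L[ℝ] 𝔄)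
    (bV : Module.Basis ι ℝ V) {C δ C' δ' θ γ' : ℝ} (hδ : 0 < δ) (hδ' : 0 < δ')
    (hU : ∀ k (v : Fin (k + 1) → ℝ), v ∈ Box γ' k →
      Decay510 (polLimit F (k + 1) (fun K => ℰ k v K) ρ bV 0 1) C δ)
    (hS : ∀ k (w : Fin (k + 2) → ℝ), w ∈ Box γ' (k + 1) →
      Decay510 (subKernel (polLimit F (k + 1 + 1) (fun K => ℰ (k + 1) w K) ρ bV)
        (polLimit F (k + 1) (fun K => ℰ k (Fin.tail w) K) ρ bV) 0 1) (C' * θ ^ k) δ') :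
    ScaleShiftRate (betaPrime510 4 C' δ') θ γ' (betaMerged F ℰ ρ bV) :=
  scaleShiftRate_secondMoment_of_kernelStepRate
    (Pk := fun k v => polLimit F (k + 1) (fun K => ℰ k v K) ρ bV) hδ hδ' hU hS

/-- **Design (α): (AF-0r) FOR THE RECORD's `beta0OfTerms` ⇐ A RATE PAIR OF THE COUPLING-FREE KERNELS.**  `beta0OfTerms F ℰ⁰ ρ bV k` IS, by `rfl`, the
second moment `Σ_x Π⁰_{k+1,01}(x) x₀x₁` of `Π⁰_{k+1} := Node00.polLimit F (k+1) (ℰ⁰ k ·) ρ bV`; a `T4RateAlgebra.RatePair` ((UD) + the step rate (PR′),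
`0 < δ`, `0 ≤ θ < 1`) of the `(0,1)` component of THESE kernels gives `|β⁰_{k+1} − β⁰_∞| ≤ β′(C′∕(1−θ), δ)·θ^k` with `β⁰_∞` the second moment of the
TELESCOPED limit kernel `Beta.LimitRate.limKernelOf` (`StepRate.geometricRate` + `abs_secondMoment_sub_limit_le` BY NAME) — N15's currency (NE2 =
`T4EtaRate.EtaRateIneqUnit` at `U ≡ 1`, `T4RateAlgebra.unitStepIneq_iff`) instantiated on record objects.  (PR′) is NOT PRINTED.
[cite: Balaban1987RG1, (1.22) p.264 and (5.10) p.293] -/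
theorem af0r_beta0OfTerms_of_ratePair (F : T4Family) (ℰ0 : TermFamily0 F 𝔄) (ρ : V →L[ℝ] 𝔄) (bV : Module.Basis ι ℝ V)
    {C δ C' θ : ℝ} (hδ : 0 < δ) (hθ0 : 0 ≤ θ) (hθ1 : θ < 1)
    (h : T4RateAlgebra.RatePair (fun k => polLimit F (k + 1) (fun K => ℰ0 k K) ρ bV 0 1) C δ C' θ) :
    ∀ k, |beta0OfTerms F ℰ0 ρ bV k
        - B12Beta.secondMoment (limKernelOf fun k => polLimit F (k + 1) (fun K => ℰ0 k K) ρ bV) 0 1|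
      ≤ betaPrime510 4 (C' / (1 - θ)) δ * θ ^ k :=
  fun k => Beta.LimitRate.abs_secondMoment_sub_limit_le
    (P := fun k => polLimit F (k + 1) (fun K => ℰ0 k K) ρ bV) (μ := 0) (ν := 1) h.decay
    (Beta.LimitRate.StepRate.geometricRate (P := fun k => polLimit F (k + 1) (fun K => ℰ0 k K) ρ bV)
      (μ := 0) (ν := 1) h.rate hθ0 hθ1) hδ hδ k

/-- **Design (α), THE HEADLINE: N17 AT THE TWO-TERM-FAMILY β OF RECORD ⇐ kernel rates of both families.**  A rate pair of the coupling-free family's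
limiting kernels (⇒ (AF-0r), `af0r_beta0OfTerms_of_ratePair`) ∧ (UD) + the history-matched step rate of the remainder family's limiting kernels on the
boxes (⇒ the β¹-rate, `scaleShiftRate_secondMoment_of_kernelStepRate`), box side `γ' ≤ γ`, `0 ≤ θ < 1` ⟹
`ScaleShiftRate (2β′(C′∕(1−θ),δ) + β′(C₁′,δ₁′)) θ γ' (betaOfTerms F ℰ⁰ ℰ¹ ρ bV γ)`.  Every kernel input a BINDER (rows NE2∕NE3∕NE5 = N15∕N16∕N18 in the
record's letters); nothing of Bałaban's asserted. [cite: Balaban1987RG1, (1.22) p.264 and (5.10) p.293] -/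
theorem scaleShiftRate_betaOfTerms_of_kernelRates (F : T4Family) (ℰ0 : TermFamily0 F 𝔄) (ℰ1 : TermFamily1 F 𝔄)
    (ρ : V →L[ℝ] 𝔄) (bV : Module.Basis ι ℝ V) {γ γ' C δ C' θ C₁ δ₁ C₁' δ₁' : ℝ}
    (hγ : γ' ≤ γ) (hδ : 0 < δ) (hθ0 : 0 ≤ θ) (hθ1 : θ < 1)
    (h0 : T4RateAlgebra.RatePair (fun k => polLimit F (k + 1) (fun K => ℰ0 k K) ρ bV 0 1) C δ C' θ)
    (hδ₁ : 0 < δ₁) (hδ₁' : 0 < δ₁')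
    (hU1 : ∀ k (v : Fin (k + 1) → ℝ), v ∈ Box γ' k →
      Decay510 (polLimit F (k + 1) (fun K => ℰ1 k v K) ρ bV 0 1) C₁ δ₁)
    (hS1 : ∀ k (w : Fin (k + 2) → ℝ), w ∈ Box γ' (k + 1) →
      Decay510 (subKernel (polLimit F (k + 1 + 1) (fun K => ℰ1 (k + 1) w K) ρ bV)
        (polLimit F (k + 1) (fun K => ℰ1 k (Fin.tail w) K) ρ bV) 0 1) (C₁' * θ ^ k) δ₁') :
    ScaleShiftRate (2 * betaPrime510 4 (C' / (1 - θ)) δ + betaPrime510 4 C₁' δ₁') θ γ'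
      (betaOfTerms F ℰ0 ℰ1 ρ bV γ) := by
  have hconv := af0r_beta0OfTerms_of_ratePair F ℰ0 ρ bV hδ hθ0 hθ1 h0
  have hc₀ : 0 ≤ betaPrime510 4 (C' / (1 - θ)) δ :=
    Beta.LimitRate.betaPrime510_nonneg (div_nonneg h0.rateConst_nonneg (by linarith))
  have h1 : ScaleShiftRate (betaPrime510 4 C₁' δ₁') θ γ' (beta1OfTerms F ℰ1 ρ bV) :=
    scaleShiftRate_secondMoment_of_kernelStepRate
      (Pk := fun k v => polLimit F (k + 1) (fun K => ℰ1 k v K) ρ bV) hδ₁ hδ₁' hU1 hS1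
  have h1' : ScaleShiftRate (betaPrime510 4 C₁' δ₁') θ γ'
      (fun k w => (beta0OfTerms F ℰ0 ρ bV k + beta1OfTerms F ℰ1 ρ bV k w) - beta0OfTerms F ℰ0 ρ bV k) :=
    (scaleShiftRate_congr_boxes (β' := beta1OfTerms F ℰ1 ρ bV) fun k v _ => add_sub_cancel_left _ _).mpr h1
  exact (scaleShiftRate_betaOfTerms_iff F ℰ0 ℰ1 ρ bV hγ).mpr
    (scaleShiftRate_merged_of_rates (βm := fun k w => beta0OfTerms F ℰ0 ρ bV k + beta1OfTerms F ℰ1 ρ bV k w)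
      hθ0 hθ1.le hc₀ hconv h1')

end KernelCurrency

section OnDatumAlpha

variable {F : T4Family} {G : Type u} [GaugeGroup G] [MeasurableSpace G] [HaarData G]
variable {𝔄 : Type*} [NormedRing 𝔄] [NormedAlgebra ℝ 𝔄]
variable {V : Type*} [NormedAddCommGroup V] [NormedSpace ℝ V] {ι : Type*} [Fintype ι]

/-- **Design (α) ON THE DATUM: N17 AT D₀ ⇐ kernel rates of the two term families of record** (§17 headline through `Spine.NE4.ne4OnData_iff`).
[cite: Balaban1987RG1, (1.22) p.264 and (5.10) p.293] -/
theorem N17_atRecordTerms_of_kernelRates (D : FiniteEpsData F G) (ℰ0 : TermFamily0 F 𝔄) (ℰ1 : TermFamily1 F 𝔄)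
    (ρ : V →L[ℝ] 𝔄) (bV : Module.Basis ι ℝ V) {γ γ' C δ C' θ C₁ δ₁ C₁' δ₁' : ℝ}
    (hD : D.βfun = betaOfTerms F ℰ0 ℰ1 ρ bV γ)
    (hγ : γ' ≤ γ) (hδ : 0 < δ) (hθ0 : 0 ≤ θ) (hθ1 : θ < 1)
    (h0 : T4RateAlgebra.RatePair (fun k => polLimit F (k + 1) (fun K => ℰ0 k K) ρ bV 0 1) C δ C' θ)
    (hδ₁ : 0 < δ₁) (hδ₁' : 0 < δ₁')
    (hU1 : ∀ k (v : Fin (k + 1) → ℝ), v ∈ Box γ' k →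
      Decay510 (polLimit F (k + 1) (fun K => ℰ1 k v K) ρ bV 0 1) C₁ δ₁)
    (hS1 : ∀ k (w : Fin (k + 2) → ℝ), w ∈ Box γ' (k + 1) →
      Decay510 (subKernel (polLimit F (k + 1 + 1) (fun K => ℰ1 (k + 1) w K) ρ bV)
        (polLimit F (k + 1) (fun K => ℰ1 k (Fin.tail w) K) ρ bV) 0 1) (C₁' * θ ^ k) δ₁') :
    NE4OnData D (2 * betaPrime510 4 (C' / (1 - θ)) δ + betaPrime510 4 C₁' δ₁') θ γ' := by
  rw [ne4OnData_iff, hD]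
  exact scaleShiftRate_betaOfTerms_of_kernelRates F ℰ0 ℰ1 ρ bV hγ hδ hθ0 hθ1 h0 hδ₁ hδ₁' hU1 hS1

end OnDatumAlpha

section AssemblyLine

variable {F : T4Family} {G : Type u} [GaugeGroup G] [MeasurableSpace G] [HaarData G]
variable {𝔄 : Type*} [NormedRing 𝔄] [NormedAlgebra ℝ 𝔄]
variable {V : Type*} [NormedAddCommGroup V] [NormedSpace ℝ V] {ι : Type*} [Fintype ι]

/-- **N17 AT THE DEFINER'S ASSEMBLY LINE, END TO END (design (β)).**  For a datum whose β-family IS the Stage-8 assembly line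
`betaOfMerged (betaMerged F ℰ ρ bV) (beta0OfMerged (betaMerged F ℰ ρ bV) v₀) γ` (def-B ∕ n09-b: `ℰ := mergedTermFamily …`, the merged term (1.6) of
record): (UD) ∧ the history-matched step rate of the record's limiting polarisation kernels `Node00.polLimit F (k+1) (ℰ k v ·) ρ bV` on the boxes
`]0,γ']`, `0 < γ' ≤ γ`, `0 ≤ θ < 1`, and the definer's `Beta0LimitExists` at a coherent admissible reference history ⟹ N17 ON THE DATUM with constant
`β′(C′,δ′)` AND (AF-0r) for the record's one-loop number `beta0OfMerged … v₀` with constant `β′(C′,δ′)∕(1−θ)` — §17 ∘ part 1 §15∕§16.  Every kernel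
rate a BINDER (rows NE2∕NE3∕NE5 in the record's letters); nothing of Bałaban's asserted. [cite: Balaban1987RG1, (1.21)-(1.22) p.264 and (5.10) p.293] -/
theorem N17_atAssemblyLine_of_kernelStepRate (D : FiniteEpsData F G) (ℰ : TermFamily1 F 𝔄) (ρ : V →L[ℝ] 𝔄)
    (bV : Module.Basis ι ℝ V) {v₀ : (k : ℕ) → (Fin (k + 1) → ℝ)} {C δ C' δ' θ γ γ' : ℝ}
    (hD : D.βfun = betaOfMerged (betaMerged F ℰ ρ bV) (beta0OfMerged (betaMerged F ℰ ρ bV) v₀) γ)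
    (hγ : γ' ≤ γ) (hγ' : 0 < γ') (hθ0 : 0 ≤ θ) (hθ1 : θ < 1) (hδ : 0 < δ) (hδ' : 0 < δ')
    (hU : ∀ k (v : Fin (k + 1) → ℝ), v ∈ Box γ' k →
      Decay510 (polLimit F (k + 1) (fun K => ℰ k v K) ρ bV 0 1) C δ)
    (hS : ∀ k (w : Fin (k + 2) → ℝ), w ∈ Box γ' (k + 1) →
      Decay510 (subKernel (polLimit F (k + 1 + 1) (fun K => ℰ (k + 1) w K) ρ bV)
        (polLimit F (k + 1) (fun K => ℰ k (Fin.tail w) K) ρ bV) 0 1) (C' * θ ^ k) δ')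
    (hlim : Beta0LimitExists (betaMerged F ℰ ρ bV) v₀) (hcoh : ∀ k, Fin.tail (v₀ (k + 1)) = v₀ k)
    (hadm : ∀ k i, 0 < v₀ k i ∧ v₀ k i ≤ γ') :
    NE4OnData D (betaPrime510 4 C' δ') θ γ' ∧
      ∃ binf : ℝ, ∀ k, |beta0OfMerged (betaMerged F ℰ ρ bV) v₀ k - binf| ≤ betaPrime510 4 C' δ' / (1 - θ) * θ ^ k := by
  have h := scaleShiftRate_betaMerged_of_kernelStepRate F ℰ ρ bV hδ hδ' hU hS
  have hc := atRecord_content_of_scaleShiftRate_merged hγ hγ' hθ0 hθ1 hlim hcoh hadm h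
  refine ⟨?_, hc.2.1⟩
  rw [ne4OnData_iff, hD]
  exact hc.1

end AssemblyLine


/-! ## §18 THE CAP AND THE GUARD — N17 at the record needs its box inside the record box (kernel negative); `γ ≤ 0` degenerates it to (AF-0r) -/

section Cap

/-- The printed shape «last coupling» `β_{k+1}(v) = 1 + g_k` satisfies NE4 with constant `0` on EVERY box (the infrared-matched histories share their
last coupling: `Fin.tail w (last k) = w (last (k+1))`). [folklore] -/
theorem scaleShiftRate_lastCoupling (θ γ' : ℝ) : ScaleShiftRate 0 θ γ' fun k v => 1 + v (Fin.last k) := by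
  intro k w _
  have ht : Fin.tail w (Fin.last k) = w (Fin.last (k + 1)) := by
    simp only [Fin.tail, Fin.succ_last]
  simp [ht]

/-- **THE CAP (kernel negative).**  For the merged β of the printed shape `1 + g_k` with one-loop number `1` and record box side `γ > 0`, the β of
record VIOLATES `ScaleShiftRate c θ γ'` for EVERY constant `c`, EVERY box side `γ' > γ` and EVERY rate `0 ≤ θ < 1`: at each scale the history
`w = (γ', γ, …, γ) ∈ ]0,γ']^{k+2}` is OFF the record box (value `β⁰_{k+2} = 1`) while `tail w = (γ, …, γ)` is ON it (value `1 + γ`), a shift `γ` that no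
`cθ^k → 0` dominates.  So N17's box at the datum of record is the record's `θ.γ` or smaller — never larger.
[cite: Balaban1987RG1, (1.22) p.264 («defined on the interval [0, γ]»)] -/
theorem not_scaleShiftRate_betaOfMerged_faceJump {γ γ' θ : ℝ} (hγ : 0 < γ) (hlt : γ < γ') (hθ1 : θ < 1) (c : ℝ) :
    ¬ ScaleShiftRate c θ γ' (betaOfMerged (fun k v => 1 + v (Fin.last k)) (fun _ => 1) γ) := by
  intro h
  have key : ∀ k : ℕ, γ ≤ c * θ ^ k := fun k => by
    let w : Fin (k + 2) → ℝ := fun i => if i = 0 then γ' else γ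
    have hw : w ∈ Box γ' (k + 1) := mem_box.mpr fun i => by
      by_cases hi : i = 0
      · simp [w, hi, hγ.trans hlt]
      · simp [w, hi, hγ, hlt.le]
    have hnot : w ∉ Box γ (k + 1) := fun hm => by
      have h0 := ((mem_box.mp hm) 0).2
      simp [w] at h0
      exact (not_le.mpr hlt) h0
    have htail : Fin.tail w = fun _ => γ := funext fun i => by
      simp [w, Fin.tail, Fin.succ_ne_zero]
    have htailmem : Fin.tail w ∈ Box γ k := by
      rw [htail]; exact mem_box.mpr fun _ => ⟨hγ, le_rfl⟩
    have h1 : betaOfMerged (fun k v => 1 + v (Fin.last k)) (fun _ => 1) γ (k + 1) w = 1 :=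
      betaOfMerged_of_notMem _ _ _ hnot
    have h2 : betaOfMerged (fun k v => 1 + v (Fin.last k)) (fun _ => 1) γ k (Fin.tail w) = 1 + γ := by
      rw [betaOfMerged_of_mem _ _ _ htailmem, htail]
    have hk := h k w hw
    rw [h1, h2, show (1 : ℝ) - (1 + γ) = -γ by ring, abs_neg, abs_of_pos hγ] at hk
    exact hk
  have hc : 0 < c := by
    have h0 := key 0
    rw [pow_zero, mul_one] at h0
    exact hγ.trans_le h0
  obtain ⟨k, hk⟩ := exists_pow_lt_of_lt_one (div_pos hγ hc) hθ1
  have h3 : c * θ ^ k < γ := by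
    calc c * θ ^ k < c * (γ / c) := mul_lt_mul_of_pos_left hk hc
      _ = γ := mul_div_cancel₀ γ hc.ne'
  exact absurd (key k) (not_le.mpr h3)

/-- **THE CAP, PACKAGED with the honest one-loop number.**  For every record box side `γ > 0`, every `γ' > γ` and every rate `θ < 1` there is a merged β
of the printed shape satisfying NE4 with constant `0` on EVERY box, whose one-sided limit `g_k → 0⁺` exists at every reference history with
`Node00.beta0OfMerged ≡ 1` (`N28AtBetaOfRecord.faceJump_beta0`), and whose β of record — literally the definer's `betaOfMerged βm (beta0OfMerged βm v₀) γ` —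
violates `ScaleShiftRate c θ γ'` for every `c`.  Hence the crux text «`NE4OnData D₀ c θ γ'`» must take `γ' ≤ θ.γ`. [cite: Balaban1987RG1, (1.22) p.264] -/
theorem exists_printedShape_scaleShiftCap {γ γ' θ : ℝ} (hγ : 0 < γ) (hlt : γ < γ') (hθ1 : θ < 1) :
    ∃ βm : HBeta, (∀ γ₁, ScaleShiftRate 0 θ γ₁ βm) ∧
      (∀ v₀, Beta0LimitExists βm v₀ ∧ beta0OfMerged βm v₀ = fun _ => 1) ∧
      ∀ v₀ (c : ℝ), ¬ ScaleShiftRate c θ γ' (betaOfMerged βm (beta0OfMerged βm v₀) γ) := by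
  refine ⟨fun k v => 1 + v (Fin.last k), fun γ₁ => scaleShiftRate_lastCoupling θ γ₁, faceJump_beta0, fun v₀ c => ?_⟩
  rw [(faceJump_beta0 v₀).2]
  exact not_scaleShiftRate_betaOfMerged_faceJump hγ hlt hθ1 c

/-- **THE GUARD.**  For a NON-POSITIVE record box side the β of record is the constant family of its one-loop numbers (`N28AtBetaOfRecord.betaOfMerged_of_nonpos`),
and N17 at the record on any box `γ' > 0` IS the Cauchy form `|β⁰_{k+2} − β⁰_{k+1}| ≤ cθ^k` of (AF-0r) — the merged β has left the statement.
[cite: Balaban1987RG1, (1.22) p.264 («defined on the interval [0, γ]»)] -/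
theorem scaleShiftRate_betaOfMerged_of_nonpos_iff {βm : HBeta} {β0 : ℕ → ℝ} {γ γ' c θ : ℝ} (hγ : γ ≤ 0) (hγ' : 0 < γ') :
    ScaleShiftRate c θ γ' (betaOfMerged βm β0 γ) ↔ ∀ k, |β0 (k + 1) - β0 k| ≤ c * θ ^ k := by
  constructor
  · intro h k
    have hw : (fun _ : Fin (k + 2) => γ') ∈ Box γ' (k + 1) := mem_box.mpr fun _ => ⟨hγ', le_rfl⟩
    have hk := h k _ hw
    rwa [betaOfMerged_of_nonpos hγ, betaOfMerged_of_nonpos hγ] at hk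
  · intro h k w _
    rw [betaOfMerged_of_nonpos hγ, betaOfMerged_of_nonpos hγ]
    exact h k

end Cap

/-! ## §19 NON-VACUITY at the record — a history-dependent merged β with k-dependent one-loop numbers for which §14–§15 hold non-trivially -/

section NonVacuity

/-- The toy's one-loop numbers are HONEST: for `β_merged,k+1(v) := 1 + 2^{−k} + g_k·2^{−k}` the one-sided limit `g_k → 0⁺` exists at every reference
history and `Node00.beta0OfMerged` IS `k ↦ 1 + 2^{−k}`. [folklore] -/
theorem toy_beta0 (v₀ : (k : ℕ) → (Fin (k + 1) → ℝ)) :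
    Beta0LimitExists (fun k v => 1 + (1 / 2 : ℝ) ^ k + v (Fin.last k) * (1 / 2 : ℝ) ^ k) v₀ ∧
      beta0OfMerged (fun k v => 1 + (1 / 2 : ℝ) ^ k + v (Fin.last k) * (1 / 2 : ℝ) ^ k) v₀ =
        fun k => 1 + (1 / 2 : ℝ) ^ k := by
  have ht : ∀ k : ℕ, Tendsto
      (fun g : ℝ => (1 : ℝ) + (1 / 2 : ℝ) ^ k
        + Function.update (v₀ k) (Fin.last k) g (Fin.last k) * (1 / 2 : ℝ) ^ k)
      (𝓝[>] (0 : ℝ)) (𝓝 (1 + (1 / 2 : ℝ) ^ k)) := fun k => by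
    simp only [Function.update_self]
    have hc : Tendsto (fun g : ℝ => (1 : ℝ) + (1 / 2 : ℝ) ^ k + g * (1 / 2 : ℝ) ^ k) (𝓝 (0 : ℝ))
        (𝓝 ((1 : ℝ) + (1 / 2 : ℝ) ^ k + 0 * (1 / 2 : ℝ) ^ k)) :=
      ((continuous_const.add (continuous_id.mul continuous_const)).tendsto 0)
    rw [zero_mul, add_zero] at hc
    exact hc.mono_left nhdsWithin_le_nhds
  refine ⟨fun k => ⟨_, ht k⟩, funext fun k => ?_⟩
  unfold beta0OfMerged
  exact (ht k).limUnder_eq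

/-- The toy's one-loop numbers converge to `β⁰_∞ = 1` at rate `½` with constant `1`. [folklore] -/
theorem toy_conv (k : ℕ) : |(1 + (1 / 2 : ℝ) ^ k) - 1| ≤ 1 * (1 / 2 : ℝ) ^ k := by
  rw [add_sub_cancel_left, one_mul, abs_of_nonneg (by positivity)]

/-- The toy's merged remainder `g_k·2^{−k}` has the scale-shift rate `½` with constant `1` on the box `]0,1]` (infrared-matched histories share the last
coupling). [folklore] -/
theorem toy_remainderRate : ScaleShiftRate 1 (1 / 2) 1 fun k (w : Fin (k + 1) → ℝ) =>
    (1 + (1 / 2 : ℝ) ^ k + w (Fin.last k) * (1 / 2 : ℝ) ^ k) - (1 + (1 / 2 : ℝ) ^ k) := by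
  intro k w hw
  have hl := (mem_box.mp hw) (Fin.last (k + 1))
  have ht : Fin.tail w (Fin.last k) = w (Fin.last (k + 1)) := by
    simp only [Fin.tail, Fin.succ_last]
  show |(1 + (1 / 2 : ℝ) ^ (k + 1) + w (Fin.last (k + 1)) * (1 / 2 : ℝ) ^ (k + 1) - (1 + (1 / 2 : ℝ) ^ (k + 1)))
      - (1 + (1 / 2 : ℝ) ^ k + Fin.tail w (Fin.last k) * (1 / 2 : ℝ) ^ k - (1 + (1 / 2 : ℝ) ^ k))|
    ≤ 1 * (1 / 2 : ℝ) ^ k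
  rw [ht]
  have e : (1 + (1 / 2 : ℝ) ^ (k + 1) + w (Fin.last (k + 1)) * (1 / 2 : ℝ) ^ (k + 1) - (1 + (1 / 2 : ℝ) ^ (k + 1)))
      - (1 + (1 / 2 : ℝ) ^ k + w (Fin.last (k + 1)) * (1 / 2 : ℝ) ^ k - (1 + (1 / 2 : ℝ) ^ k))
      = -(w (Fin.last (k + 1)) * ((1 / 2 : ℝ) * (1 / 2 : ℝ) ^ k)) := by
    rw [pow_succ]; ring
  have hp : (0 : ℝ) < (1 / 2 : ℝ) ^ k := pow_pos (by norm_num) k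
  rw [e, abs_neg, abs_of_nonneg (by nlinarith [hl.1, hp])]
  nlinarith [hl.1, hl.2, hp]

/-- **NON-VACUITY OF §14–§15 AT THE RECORD.**  For the toy merged β with its HONEST one-loop numbers `β⁰_k = 1 + 2^{−k}` (`toy_beta0`): (AF-0r) with
`β⁰_∞ = 1`, `c₀ = 1`, rate `½`; the merged remainder has `ScaleShiftRate 1 ½ 1`; hence N17 holds for the merged β AND for the β of record
`betaOfMerged βm β⁰ 1` with constant `3`, rate `½`, box `1` — every hypothesis of `scaleShiftRate_betaOfMerged_of_rates` ∕
`atRecord_content_of_scaleShiftRate_merged` inhabited by a history-dependent family with k-dependent one-loop numbers. [folklore] -/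
theorem N17_atRecord_toy (v₀ : (k : ℕ) → (Fin (k + 1) → ℝ)) :
    ∃ (βm : HBeta) (β0 : ℕ → ℝ),
      (Beta0LimitExists βm v₀ ∧ beta0OfMerged βm v₀ = β0) ∧
      (∀ k, |β0 k - 1| ≤ 1 * (1 / 2 : ℝ) ^ k) ∧
      ScaleShiftRate 1 (1 / 2) 1 (fun k w => βm k w - β0 k) ∧
      ScaleShiftRate 3 (1 / 2) 1 βm ∧
      ScaleShiftRate 3 (1 / 2) 1 (betaOfMerged βm β0 1) := by
  refine ⟨fun k v => 1 + (1 / 2 : ℝ) ^ k + v (Fin.last k) * (1 / 2 : ℝ) ^ k, fun k => 1 + (1 / 2 : ℝ) ^ k,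
    toy_beta0 v₀, toy_conv, toy_remainderRate, ?_, ?_⟩
  · have h := scaleShiftRate_merged_of_rates
      (βm := fun k v => 1 + (1 / 2 : ℝ) ^ k + v (Fin.last k) * (1 / 2 : ℝ) ^ k)
      (β0 := fun k => 1 + (1 / 2 : ℝ) ^ k) (by norm_num) (by norm_num) zero_le_one toy_conv toy_remainderRate
    norm_num at h
    exact h
  · have h := scaleShiftRate_betaOfMerged_of_rates (γ := 1)
      (βm := fun k v => 1 + (1 / 2 : ℝ) ^ k + v (Fin.last k) * (1 / 2 : ℝ) ^ k)
      (β0 := fun k => 1 + (1 / 2 : ℝ) ^ k) le_rfl (by norm_num) (by norm_num) zero_le_one toy_conv toy_remainderRate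
    norm_num at h
    exact h

/-- **NON-VACUITY OF §17's KERNEL ROAD** (abstract kernels): the history-independent model kernels `Π_{k+1,μν}(v; x) := (1 + 2^{−k})e^{−|x|₁}`
(`T4RateAlgebra.Witness.X`, a `RatePair` with `C = 2`, `δ = 1`, `C′ = θ = ½`) satisfy (UD) and the history-matched step rate on every box, so
`scaleShiftRate_secondMoment_of_kernelStepRate` yields `ScaleShiftRate (β′(½,1)) ½ γ'` for their second moments. [folklore] -/
theorem kernelRoad_toy (d : ℕ) (μ ν : Fin d) (γ' : ℝ) :
    ScaleShiftRate (betaPrime510 d (1 / 2) 1) (1 / 2) γ'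
      fun k (_ : Fin (k + 1) → ℝ) => B12Beta.secondMoment (fun _ _ => T4RateAlgebra.Witness.X d k) μ ν :=
  scaleShiftRate_secondMoment_of_kernelStepRate (Pk := fun k _ => fun _ _ => T4RateAlgebra.Witness.X d k)
    one_pos one_pos (fun k _ _ => (T4RateAlgebra.Witness.ratePair d).decay k)
    (fun k _ _ => (T4RateAlgebra.Witness.ratePair d).rate k)

end NonVacuity

end Summit.QuantumFields.YangMills.Theorems.BalabanUVNodesN17
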